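import Summits.Ventures.HodgeRepro2.T5SU11LegendreIdentities

/-!
# `n ↦ φ_{2n+2}(g)` is log-convex: `P_{n+1}(x)² ≤ P_n(x) P_{n+2}(x)` for `x ≥ 1` (Laplace's integral + Cauchy–Schwarz),
`P_{n+1}(x) ≥ x P_n(x)`, and the ratios `P_{n+1}/P_n` increase in `n`

Laplace's first integral `P_m(cosh 2t) = ∫_K f(u)^m du`, `f(u) = |cosh t − ū² sinh t|² ≥ 0`
(`T5SU11SphericalLegendreLaplace.legP_cosh_eq_integral_pow`), writes `P_{n+1} = ∫ √(fⁿ) √(f^{n+2})`, and the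
Cauchy–Schwarz inequality for the probability measure `du` (`integral_mul_sq_le`, proved by the discriminant of
`λ ↦ ∫ (g − λh)²`) gives **`P_{n+1}(cosh 2t)² ≤ P_n(cosh 2t) P_{n+2}(cosh 2t)`**, i.e. for every `x ≥ 1`

  **`P_{n+1}(x)² ≤ P_n(x) P_{n+2}(x)`**   (`legP_sq_le_mul`) — `n ↦ P_n(x)` is log-convex on `[1, ∞)`,

the REVERSE of Turán's inequality (which holds on `[−1, 1]`). Consequences on `[1, ∞)`: the ratios
**`P_{n+1}/P_n ≤ P_{n+2}/P_{n+1}`** increase in `n` (`legP_ratio_mono`), starting from `P_1/P_0 = x`, so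
**`x P_n(x) ≤ P_{n+1}(x)`** (`mul_legP_le_legP_succ`) — sharper than Jensen's `xⁿ ≤ P_n(x)` — and `n ↦ P_n(x)` is
monotone (`legP_mono`). On the group: **`φ_{2n+4}(g)² ≤ φ_{2n+2}(g) φ_{2n+6}(g)`** (`sph_even_sq_le_mul`) and
**`φ_4(g) φ_{2n+2}(g) ≤ φ_{2n+4}(g)`** (`sph_four_mul_sph_even_le`) for every `g`. Nothing is claimed about (N).

Blind lane: Mathlib + the HodgeRepro2 prefix only; no sorry; axioms ⊆ {propext, Classical.choice,
Quot.sound}.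
-/

namespace Summit.Ventures.HodgeRepro2.T5SU11LegendreLogConvex

open MeasureTheory Metric Set Filter Topology Finset
open T5HaarCircle T5SU11Unimodular T5SU11Cartan T5SU11SphericalFunction T5SU11SphericalBounds
  T5SU11SphericalLegendre T5SU11SphericalLegendreAll T5SU11SphericalLegendreLaplace T5SU11LegendreIdentities
  T5BergmanCoeffL2

section measure

variable [MeasurableSpace Circle] [BorelSpace Circle]

/-! ### Cauchy–Schwarz on the circle -/

/-- **Cauchy–Schwarz for continuous functions on `K`**: `(∫ g h)² ≤ (∫ g²)(∫ h²)`. -/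
theorem integral_mul_sq_le {g h : Circle → ℝ} (hg : Continuous g) (hh : Continuous h) :
    (∫ u, g u * h u ∂haarCircle) ^ 2 ≤ (∫ u, g u ^ 2 ∂haarCircle) * ∫ u, h u ^ 2 ∂haarCircle := by
  set A := ∫ u, g u ^ 2 ∂haarCircle with hA
  set B := ∫ u, g u * h u ∂haarCircle with hB
  set C := ∫ u, h u ^ 2 ∂haarCircle with hC
  have key : ∀ l : ℝ, 0 ≤ A - 2 * l * B + l ^ 2 * C := fun l => by
    have h0 : 0 ≤ ∫ u, (g u - l * h u) ^ 2 ∂haarCircle := integral_nonneg fun u => sq_nonneg _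
    have e : ∫ u, (g u - l * h u) ^ 2 ∂haarCircle = A - 2 * l * B + l ^ 2 * C := by
      have e1 : ∀ u, (g u - l * h u) ^ 2 = g u ^ 2 - 2 * l * (g u * h u) + l ^ 2 * h u ^ 2 := fun u => by ring
      simp_rw [e1]
      rw [integral_add, integral_sub, integral_const_mul, integral_const_mul]
      · exact integrable_circle_of_continuous (hg.pow 2)
      · exact integrable_circle_of_continuous ((hg.mul hh).const_mul _)
      · exact integrable_circle_of_continuous ((hg.pow 2).sub ((hg.mul hh).const_mul _))
      · exact integrable_circle_of_continuous ((hh.pow 2).const_mul _)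
    rw [← e]
    exact h0
  have hC0 : 0 ≤ C := integral_nonneg fun u => sq_nonneg _
  rcases hC0.lt_or_eq with hCpos | hCzero
  · have := key (B / C)
    have hC' : C ≠ 0 := hCpos.ne'
    have : 0 ≤ (A * C - B ^ 2) / C := by
      rw [show (A * C - B ^ 2) / C = A - 2 * (B / C) * B + (B / C) ^ 2 * C by field_simp; ring]
      exact this
    have := (div_nonneg_iff.mp this).resolve_right fun h => absurd h.2 (not_le.mpr hCpos)
    linarith [this.1]
  · rw [← hCzero]
    have hB : B = 0 := by
      by_contra hB
      have := key ((A + 1) / (2 * B))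
      rw [← hCzero] at this
      have e : A - 2 * ((A + 1) / (2 * B)) * B + ((A + 1) / (2 * B)) ^ 2 * 0 = -1 := by
        field_simp
        ring
      linarith
    rw [hB]
    norm_num

/-! ### Log-convexity in `n` -/

/-- **`P_{n+1}(cosh 2t)² ≤ P_n(cosh 2t) P_{n+2}(cosh 2t)`**, by Cauchy–Schwarz in Laplace's integral. -/
theorem legP_cosh_sq_le_mul (n : ℕ) (t : ℝ) :
    legP (n + 1) (Real.cosh (2 * t)) ^ 2 ≤ legP n (Real.cosh (2 * t)) * legP (n + 2) (Real.cosh (2 * t)) := by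
  set f : Circle → ℝ := fun u => ‖(Real.cosh t : ℂ) - (starRingEnd ℂ) (u : ℂ) ^ 2 * Real.sinh t‖ ^ 2 with hf
  have hfc : Continuous f := continuous_kint_sq t
  have hf0 : ∀ u, 0 ≤ f u := fun u => sq_nonneg _
  have e : ∀ m : ℕ, legP m (Real.cosh (2 * t)) = ∫ u, f u ^ m ∂haarCircle := fun m =>
    legP_cosh_eq_integral_pow m t
  rw [e, e, e]
  have h := integral_mul_sq_le (g := fun u => Real.sqrt (f u ^ n)) (h := fun u => Real.sqrt (f u ^ (n + 2)))
    (Real.continuous_sqrt.comp (hfc.pow n)) (Real.continuous_sqrt.comp (hfc.pow (n + 2)))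
  have e1 : ∀ u, Real.sqrt (f u ^ n) * Real.sqrt (f u ^ (n + 2)) = f u ^ (n + 1) := fun u => by
    rw [← Real.sqrt_mul (pow_nonneg (hf0 u) n), show f u ^ n * f u ^ (n + 2) = (f u ^ (n + 1)) ^ 2 by ring,
      Real.sqrt_sq (pow_nonneg (hf0 u) _)]
  have e2 : ∀ u, Real.sqrt (f u ^ n) ^ 2 = f u ^ n := fun u => Real.sq_sqrt (pow_nonneg (hf0 u) n)
  have e3 : ∀ u, Real.sqrt (f u ^ (n + 2)) ^ 2 = f u ^ (n + 2) := fun u => Real.sq_sqrt (pow_nonneg (hf0 u) _)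
  simp only [e1, e2, e3] at h
  exact h

/-- **`P_{n+1}(x)² ≤ P_n(x) P_{n+2}(x)` for `x ≥ 1`**: `n ↦ P_n(x)` is log-convex on `[1, ∞)`. -/
theorem legP_sq_le_mul (n : ℕ) {x : ℝ} (hx : 1 ≤ x) : legP (n + 1) x ^ 2 ≤ legP n x * legP (n + 2) x := by
  obtain ⟨t, -, ht⟩ := exists_cosh_two_mul_eq hx
  rw [← ht]
  exact legP_cosh_sq_le_mul n t

/-- **The ratios increase**: `P_{n+1}/P_n ≤ P_{n+2}/P_{n+1}` on `[1, ∞)`. -/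
theorem legP_ratio_mono (n : ℕ) {x : ℝ} (hx : 1 ≤ x) :
    legP (n + 1) x / legP n x ≤ legP (n + 2) x / legP (n + 1) x := by
  have h0 : 0 < legP n x := by linarith [one_le_legP n hx]
  have h1 : 0 < legP (n + 1) x := by linarith [one_le_legP (n + 1) hx]
  rw [div_le_div_iff₀ h0 h1]
  have := legP_sq_le_mul n hx
  nlinarith

/-- **`x P_n(x) ≤ P_{n+1}(x)` for `x ≥ 1`** (the ratios start at `P_1/P_0 = x`). -/
theorem mul_legP_le_legP_succ (n : ℕ) {x : ℝ} (hx : 1 ≤ x) : x * legP n x ≤ legP (n + 1) x := by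
  have hr : ∀ m : ℕ, x ≤ legP (m + 1) x / legP m x := by
    intro m
    induction m with
    | zero => simp [legP_one']
    | succ m ih => exact ih.trans (legP_ratio_mono m hx)
  have h0 : 0 < legP n x := by linarith [one_le_legP n hx]
  have := hr n
  rwa [le_div_iff₀ h0] at this

/-- **`n ↦ P_n(x)` is monotone for `x ≥ 1`.** -/
theorem legP_mono {x : ℝ} (hx : 1 ≤ x) : Monotone fun n => legP n x := by
  refine monotone_nat_of_le_succ fun n => ?_
  have h0 : 0 ≤ legP n x := by linarith [one_le_legP n hx]
  calc legP n x = 1 * legP n x := (one_mul _).symm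
    _ ≤ x * legP n x := mul_le_mul_of_nonneg_right hx h0
    _ ≤ legP (n + 1) x := mul_legP_le_legP_succ n hx

/-! ### On the group -/

/-- **`φ_{2n+4}(g)² ≤ φ_{2n+2}(g) φ_{2n+6}(g)`**: log-convexity in the parameter at the even integers. -/
theorem sph_even_sq_le_mul (n : ℕ) (g : SU11) :
    sph (2 * ((n : ℝ) + 1) + 2) g ^ 2 ≤ sph (2 * (n : ℝ) + 2) g * sph (2 * ((n : ℝ) + 2) + 2) g := by
  have e1 : sph (2 * ((n : ℝ) + 1) + 2) g = legP (n + 1) (sph 4 g) := by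
    have := sph_even_eq_sph_four (n + 1) g
    push_cast at this
    exact this
  have e2 : sph (2 * ((n : ℝ) + 2) + 2) g = legP (n + 2) (sph 4 g) := by
    have := sph_even_eq_sph_four (n + 2) g
    push_cast at this
    exact this
  rw [e1, e2, sph_even_eq_sph_four]
  exact legP_sq_le_mul n (one_le_sph_four g)

/-- **`φ_4(g) φ_{2n+2}(g) ≤ φ_{2n+4}(g)`** for every `g`. -/
theorem sph_four_mul_sph_even_le (n : ℕ) (g : SU11) :
    sph 4 g * sph (2 * (n : ℝ) + 2) g ≤ sph (2 * ((n : ℝ) + 1) + 2) g := by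
  have e1 : sph (2 * ((n : ℝ) + 1) + 2) g = legP (n + 1) (sph 4 g) := by
    have := sph_even_eq_sph_four (n + 1) g
    push_cast at this
    exact this
  rw [e1, sph_even_eq_sph_four]
  exact mul_legP_le_legP_succ n (one_le_sph_four g)

end measure

end Summit.Ventures.HodgeRepro2.T5SU11LegendreLogConvex
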